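import Summits.NavierStokesRegularity.NavierStokesRegularity.Theorems.DriftChargedClockInhabitant
import HarnessLib

/-!
# StrainClockBudgetedSharp — door D6 «BudgetedDriftSmoothing» (ROUND-39) is SHARP AT THE LOG SCALE in its own frame

Source: nsreg-p1 g32 ROUND-40, `r40/Sketch44.lean` (sha16 a581158d31a6de3e) §2–§9 VERBATIM; §1 (`diag(1,−1,0)`) is
`PlanarStrain.D` & co. of `Theorems/DriftChargedClockInhabitant.lean` (p670188), opened below. For every `γ > 0`,
`T > 0`, `c < 1` the BURSTING planar strain `u(t,x) = (γ(T−t))⁻¹·(x₀, −x₁, 0)` (Craik–Criminale pressure) is a classical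
Navier–Stokes solution on `[0,T) × ℝ³` in D6's velocity-free frame (§3; `∇u` bounded on compact sub-slabs); its exact
`ε`-penalised strain maximisers are `(0, ±e₀)` (§5); there the total feed is `(1+γ)q² = c q² + b(t)·q` EXACTLY with
`b = σ/(T−t)`, `σ = (1+γ−c)/γ > 1` (§6); the primitive `Φ = σ·log(T/(T−t))` has `Φ(0) = 0`, `0 ≤ Φ`, `Φ′ = b` on
`[0,T)` and `Φ → +∞` (§7) — every hypothesis of D6 except `Φ ≤ β` — while the charged weighted strain `(γ(T−t))⁻¹ → +∞`
(§8): D6's conclusion fails for every `β` (`budgetedDriftSmoothing_sharp`, `weightedStrain_unbounded`, §9). Hence no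
door «`Φ ≤ σ·log(1/(T−t)) + β` ⇒ bounded weighted strain» holds in D6's frame for any `σ > 1` (all realised).
HONEST LABEL: finite-dimensional verification on an explicit INFINITE-ENERGY exact solution; no PDE estimate; nothing
about D5's Sobolev frame, 0056 / 10661, or regularity. WHAT THIS IS NOT: not a door, not a route; item 0056 `NoTypeII`
and NS regularity are NOT proved. Landed by the S-door LEAD, `--supports stmt-NavierStokesRegularity-0056 --as helper`.
-/

set_option linter.dupNamespace false
open Set Function WithLp Filter
open scoped ContDiff InnerProductSpace RealInnerProductSpace Topology

namespace Summit.NavierStokesRegularity.NavierStokesRegularity.Theorems.StrainDoors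

open Literature.Analysis.FluidPDE Literature.Analysis.FluidPDE.VectorCalculus

noncomputable section

namespace PlanarStrainBurst
open PlanarStrain (strainFun D D_apply inner_D inner_D_D inner_D_symm trace_D)

/-! ## §2 The bursting amplitude `a(t) = (γ(T−t))⁻¹` -/
/-- support (definition): `a(t) = (γ(T−t))⁻¹` (`a′ = γa²`, `a ↑ +∞` as `t ↑ T`). -/
def amp (γ T t : ℝ) : ℝ := (γ * (T - t))⁻¹
/-- `0 < γ(T−t)` for `γ > 0`, `t < T`. -/
theorem den_pos {γ T t : ℝ} (hγ : 0 < γ) (ht : t < T) : 0 < γ * (T - t) :=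
  mul_pos hγ (sub_pos.2 ht)
/-- `0 < a(t)` for `γ > 0`, `t < T`. -/
theorem amp_pos {γ T t : ℝ} (hγ : 0 < γ) (ht : t < T) : 0 < amp γ T t :=
  inv_pos.2 (den_pos hγ ht)
/-- `a` is increasing on `(-∞, T)`. -/
theorem amp_mono {γ T t t' : ℝ} (hγ : 0 < γ) (htt' : t ≤ t') (ht' : t' < T) : amp γ T t ≤ amp γ T t' := by
  have h : γ * (T - t') ≤ γ * (T - t) := mul_le_mul_of_nonneg_left (by linarith) hγ.le
  have := inv_anti₀ (den_pos hγ ht') h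
  simpa [amp] using this
/-- `a′ = γ·a²` wherever `γ(T−t) ≠ 0`. -/
theorem hasDerivAt_amp {γ T t : ℝ} (h : γ * (T - t) ≠ 0) :
    HasDerivAt (amp γ T) (γ * amp γ T t ^ 2) t := by
  have h1 : HasDerivAt (fun s => γ * (T - s)) (γ * (0 - 1)) t :=
    ((hasDerivAt_const t T).sub (hasDerivAt_id t)).const_mul γ
  have h2 := h1.inv h
  refine h2.congr_deriv ?_
  rw [amp, inv_pow, div_eq_mul_inv]
  ring
/-- `a` is smooth on `[0,T)`. -/
theorem contDiffOn_amp {γ T : ℝ} (hγ : 0 < γ) : ContDiffOn ℝ ∞ (amp γ T) (Ico 0 T) := by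
  have h : ContDiffOn ℝ ∞ (fun s : ℝ => γ * (T - s)) (Ico 0 T) :=
    contDiffOn_const.mul (contDiffOn_const.sub contDiffOn_id)
  exact h.inv fun s hs => (den_pos hγ hs.2).ne'
/-- `T − t → 0⁺` as `t ↑ T`. -/
theorem tendsto_sub_nhdsLT (T : ℝ) : Tendsto (fun t => T - t) (𝓝[<] T) (𝓝[>] 0) := by
  refine tendsto_nhdsWithin_of_tendsto_nhds_of_eventually_within _ ?_ ?_
  · have hc : Continuous (fun t : ℝ => T - t) := continuous_const.sub continuous_id
    have := hc.tendsto T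
    rw [sub_self] at this
    exact this.mono_left nhdsWithin_le_nhds
  · filter_upwards [self_mem_nhdsWithin] with t ht
    exact mem_Ioi.2 (sub_pos.2 (mem_Iio.1 ht))
/-- `a(t) → +∞` as `t ↑ T`. -/
theorem tendsto_amp_atTop {γ T : ℝ} (hγ : 0 < γ) : Tendsto (amp γ T) (𝓝[<] T) atTop := by
  have h1 : Tendsto (fun t => (T - t)⁻¹) (𝓝[<] T) atTop := tendsto_inv_nhdsGT_zero.comp (tendsto_sub_nhdsLT T)
  have h2 := h1.const_mul_atTop (inv_pos.2 hγ)
  have he : amp γ T = fun t => γ⁻¹ * (T - t)⁻¹ := by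
    funext t
    rw [amp, mul_inv]
  rw [he]
  exact h2

/-! ## §3 The flow: `S(t) = a(t) D`, `S′(t) = γ a(t)² D`, `u = S x`, Craik–Criminale pressure -/
/-- support (definition): `S(t) = a(t)·D`. -/
def S (γ T : ℝ) (t : ℝ) : EuclideanSpace ℝ (Fin 3) →L[ℝ] EuclideanSpace ℝ (Fin 3) := amp γ T t • D
/-- support (definition): `S′(t) = γ a(t)²·D`. -/
def S' (γ T : ℝ) (t : ℝ) : EuclideanSpace ℝ (Fin 3) →L[ℝ] EuclideanSpace ℝ (Fin 3) := (γ * amp γ T t ^ 2) • D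

/-- support (definition): the velocity `u(t,x) = a(t)(x₀, −x₁, 0)`. -/
def u (γ T : ℝ) : ℝ → EuclideanSpace ℝ (Fin 3) → EuclideanSpace ℝ (Fin 3) :=
  LinearFlow.velocity (S γ T) (fun _ => 0)

/-- support (definition): the pressure `p(t,x) = −½⟪x, (S′ + S²)(t) x⟫`. -/
def p (γ T : ℝ) : ℝ → EuclideanSpace ℝ (Fin 3) → ℝ :=
  LinearFlow.pressure (S γ T) (S' γ T) (fun _ => 0) (fun _ => 0) (fun _ => 0)
/-- `u(t,x) = a(t)·D x` (unfolding lemma). -/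
theorem u_apply (γ T t : ℝ) (x : EuclideanSpace ℝ (Fin 3)) : u γ T t x = amp γ T t • D x := by
  simp [u, S]
/-- `u(t,0) = 0`. -/
theorem u_apply_zero (γ T t : ℝ) : u γ T t 0 = 0 := by
  simp [u_apply]
/-- `∇u(t,x) = a(t)·D`. -/
theorem fderiv_u (γ T t : ℝ) (x : EuclideanSpace ℝ (Fin 3)) : fderiv ℝ (u γ T t) x = amp γ T t • D := by
  rw [u, LinearFlow.fderiv_velocity]; rfl

/-- The Craik–Criminale matrix `S′ + S²` is symmetric (both are multiples of `D`, `D²`). -/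
theorem inner_cc (γ T t : ℝ) (x y : EuclideanSpace ℝ (Fin 3)) :
    ⟪LinearFlow.ccMatrix (S γ T) (S' γ T) t x, y⟫ =
      (γ * amp γ T t ^ 2) * (x 0 * y 0 - x 1 * y 1) + amp γ T t ^ 2 * (x 0 * y 0 + x 1 * y 1) := by
  rw [LinearFlow.ccMatrix_apply, S, S']
  show ⟪(γ * amp γ T t ^ 2) • D x + amp γ T t • D (amp γ T t • D x), y⟫ = _
  rw [map_smul, smul_smul, inner_add_left, real_inner_smul_left, real_inner_smul_left, inner_D, inner_D_D]
  ring
/-- The Craik–Criminale matrix `S′ + S²` is symmetric (inner-product form). -/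
theorem cc_symm (γ T t : ℝ) (x y : EuclideanSpace ℝ (Fin 3)) :
    ⟪LinearFlow.ccMatrix (S γ T) (S' γ T) t x, y⟫ = ⟪x, LinearFlow.ccMatrix (S γ T) (S' γ T) t y⟫ := by
  rw [real_inner_comm (LinearFlow.ccMatrix (S γ T) (S' γ T) t y) x, inner_cc, inner_cc]; ring
/-- `tr S(t) = 0` (incompressibility of the linear flow). -/
theorem trace_S (γ T t : ℝ) :
    LinearMap.trace ℝ _ (S γ T t : EuclideanSpace ℝ (Fin 3) →ₗ[ℝ] EuclideanSpace ℝ (Fin 3)) = 0 := by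
  rw [S, ContinuousLinearMap.toLinearMap_smul, map_smul, trace_D, smul_zero]

/-- **The bursting planar strain is a classical Navier–Stokes solution on `[0,T) × ℝ³`** for every viscosity
(force `0`), by the tree's Craik–Criminale theorem `LinearFlow.isClassicalNSSolutionOn`. -/
theorem isClassicalNSSolutionOn {γ T : ℝ} (hγ : 0 < γ) (ν : ℝ) :
    IsClassicalNSSolutionOn (Ico 0 T) ν 0 (u γ T) (p γ T) := by
  have hamp := contDiffOn_amp (T := T) hγ
  have hSc : ContDiffOn ℝ ∞ (S γ T) (Ico 0 T) := hamp.smul contDiffOn_const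
  have hS'c : ContDiffOn ℝ ∞ (S' γ T) (Ico 0 T) :=
    (contDiffOn_const.mul (hamp.pow 2)).smul contDiffOn_const
  have hdS : ∀ t ∈ Ico 0 T, HasDerivWithinAt (S γ T) (S' γ T t) (Ico 0 T) t := by
    intro t ht
    have h := (hasDerivAt_amp (γ := γ) (T := T) (t := t) (den_pos hγ ht.2).ne').smul_const D
    exact h.hasDerivWithinAt
  have hdU : ∀ t ∈ Ico 0 T, HasDerivWithinAt (fun _ : ℝ => (0 : EuclideanSpace ℝ (Fin 3))) 0 (Ico 0 T) t :=
    fun t _ => hasDerivWithinAt_const t _ _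
  have h := LinearFlow.isClassicalNSSolutionOn (S γ T) (S' γ T) (fun _ => 0) (fun _ => 0) (fun _ => 0)
    (uniqueDiffOn_Ico 0 T) ν hSc hS'c contDiffOn_const contDiffOn_const contDiffOn_const hdS hdU
    (fun t _ => trace_S γ T t) (fun t _ => cc_symm γ T t)
  exact h

/-- **D6's second frame hypothesis**: the velocity gradient is bounded on every compact sub-slab `[0,T'] × ℝ³`,
`T' < T` (`‖∇u(t,x)‖ = a(t)‖D‖ ≤ a(T')‖D‖`), although it is unbounded on `[0,T)`. -/
theorem fderiv_locally_bounded {γ T : ℝ} (hγ : 0 < γ) :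
    ∀ T' : ℝ, T' < T → ∃ K : ℝ, ∀ t ∈ Icc 0 T', ∀ x : EuclideanSpace ℝ (Fin 3), ‖fderiv ℝ (u γ T t) x‖ ≤ K := by
  intro T' hT'
  refine ⟨amp γ T T' * ‖D‖, fun t ht x => ?_⟩
  have htT : t < T := lt_of_le_of_lt ht.2 hT'
  rw [fderiv_u, norm_smul, Real.norm_of_nonneg (amp_pos hγ htT).le]
  exact mul_le_mul_of_nonneg_right (amp_mono hγ ht.2 hT') (norm_nonneg _)

/-! ## §4 Strain form, vorticity, pressure Hessian and feed of the flow -/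
/-- `⟪∇u(t,x)e,e⟫ = a(t)(e₀² − e₁²)` (independent of `x`). -/
theorem strainQuad_u (γ T t : ℝ) (x e : EuclideanSpace ℝ (Fin 3)) :
    strainQuad (u γ T) t x e = amp γ T t * (e 0 ^ 2 - e 1 ^ 2) := by
  rw [strainQuad, fderiv_u]
  show ⟪amp γ T t • D e, e⟫ = _
  rw [real_inner_smul_left, inner_D]
  ring

/-- The flow is irrotational: `curl u(t,·) ≡ 0`. -/
theorem curl_u (γ T t : ℝ) (x : EuclideanSpace ℝ (Fin 3)) : curl (u γ T t) x = 0 := by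
  ext i
  fin_cases i <;> simp [curl, fderiv_u]

/-- `∇p(t,·) = −(S′ + S²)(t)·`, hence `∇²p(t,x) = −(S′ + S²)(t)`. -/
theorem fderiv_gradient_p (γ T t : ℝ) (x : EuclideanSpace ℝ (Fin 3)) :
    fderiv ℝ (gradient (p γ T t)) x = -(LinearFlow.ccMatrix (S γ T) (S' γ T) t) := by
  have hg : gradient (p γ T t) = fun y => -(LinearFlow.ccMatrix (S γ T) (S' γ T) t y) := by
    funext y
    rw [p, LinearFlow.gradient_pressure (S γ T) (S' γ T) (fun _ => 0) (fun _ => 0) (fun _ => 0)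
      (cc_symm γ T t) y]
    simp
  rw [hg]
  exact ((LinearFlow.ccMatrix (S γ T) (S' γ T) t).hasFDerivAt.neg).fderiv

/-- The strain feed of the flow: `H(t,x,e) = a(t)²((1+γ)e₀² + (1−γ)e₁²)`. -/
theorem strainFeed_u (γ T t : ℝ) (x e : EuclideanSpace ℝ (Fin 3)) :
    strainFeed (u γ T) (p γ T) t x e = amp γ T t ^ 2 * ((1 + γ) * e 0 ^ 2 + (1 - γ) * e 1 ^ 2) := by
  rw [strainFeed, curl_u, pressureHess, fderiv_gradient_p]
  show (1 / 4 : ℝ) * (‖(0 : EuclideanSpace ℝ (Fin 3))‖ ^ 2 - ⟪(0 : EuclideanSpace ℝ (Fin 3)), e⟫ ^ 2) -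
      ⟪-(LinearFlow.ccMatrix (S γ T) (S' γ T) t e), e⟫ = _
  rw [inner_neg_left, inner_cc]
  simp
  ring

/-! ## §5 The penalised maximisers are exactly `(0, ±e₀)` (Sketch41/43 §5 with the new amplitude) -/
/-- `‖e‖² = e₀² + e₁² + e₂²` on `ℝ³`. -/
private theorem norm_sq_coords (e : EuclideanSpace ℝ (Fin 3)) : ‖e‖ ^ 2 = e 0 ^ 2 + e 1 ^ 2 + e 2 ^ 2 := by
  rw [EuclideanSpace.real_norm_sq_eq, Fin.sum_univ_three]

/-- `(0, e₀)` is an exact `ε`-penalised strain maximiser at every time with `a(t) > 0`. -/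
theorem isStrainPenalisedArgmax_origin {γ T ε t : ℝ} (hε : 0 < ε) (ha : 0 < amp γ T t) :
    IsStrainPenalisedArgmax ε (u γ T) t 0 (EuclideanSpace.single 0 1) := by
  refine ⟨by simp, fun y e' he' => ?_⟩
  rw [strainQuad_u, strainQuad_u]
  have hn := norm_sq_coords e'
  rw [he', one_pow] at hn
  have hw0 : 0 < (1 + ε * ‖y‖ ^ 2)⁻¹ := by positivity
  have hw1 : (1 + ε * ‖y‖ ^ 2)⁻¹ ≤ 1 := inv_le_one_of_one_le₀ (by nlinarith [norm_nonneg y])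
  have hq : amp γ T t * (e' 0 ^ 2 - e' 1 ^ 2) ≤ amp γ T t := by nlinarith [sq_nonneg (e' 1), sq_nonneg (e' 2)]
  have hrhs : (1 + ε * ‖(0 : EuclideanSpace ℝ (Fin 3))‖ ^ 2)⁻¹ *
      (amp γ T t * ((EuclideanSpace.single 0 (1 : ℝ) : EuclideanSpace ℝ (Fin 3)) 0 ^ 2 -
        (EuclideanSpace.single 0 (1 : ℝ) : EuclideanSpace ℝ (Fin 3)) 1 ^ 2)) = amp γ T t := by
    simp
  rw [hrhs]
  by_cases hsgn : 0 ≤ amp γ T t * (e' 0 ^ 2 - e' 1 ^ 2)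
  · calc (1 + ε * ‖y‖ ^ 2)⁻¹ * (amp γ T t * (e' 0 ^ 2 - e' 1 ^ 2))
        ≤ 1 * (amp γ T t * (e' 0 ^ 2 - e' 1 ^ 2)) := mul_le_mul_of_nonneg_right hw1 hsgn
      _ ≤ amp γ T t := by rw [one_mul]; exact hq
  · have : (1 + ε * ‖y‖ ^ 2)⁻¹ * (amp γ T t * (e' 0 ^ 2 - e' 1 ^ 2)) ≤ 0 :=
      mul_nonpos_of_nonneg_of_nonpos hw0.le (lt_of_not_ge hsgn).le
    linarith

/-- Conversely every exact `ε`-penalised maximiser sits at the origin along `±e₀`. -/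
theorem eq_of_isStrainPenalisedArgmax {γ T ε t : ℝ} (hε : 0 < ε) (ha : 0 < amp γ T t)
    {x e : EuclideanSpace ℝ (Fin 3)} (h : IsStrainPenalisedArgmax ε (u γ T) t x e) :
    x = 0 ∧ e 0 ^ 2 = 1 ∧ e 1 = 0 ∧ e 2 = 0 := by
  obtain ⟨he, hmax⟩ := h
  have hn := norm_sq_coords e
  rw [he, one_pow] at hn
  have hm := hmax 0 (EuclideanSpace.single 0 1) (by simp)
  rw [strainQuad_u, strainQuad_u] at hm
  have hlhs : (1 + ε * ‖(0 : EuclideanSpace ℝ (Fin 3))‖ ^ 2)⁻¹ *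
      (amp γ T t * ((EuclideanSpace.single 0 (1 : ℝ) : EuclideanSpace ℝ (Fin 3)) 0 ^ 2 -
        (EuclideanSpace.single 0 (1 : ℝ) : EuclideanSpace ℝ (Fin 3)) 1 ^ 2)) = amp γ T t := by
    simp
  rw [hlhs] at hm
  set w := (1 + ε * ‖x‖ ^ 2)⁻¹ with hw
  have hw0 : 0 < w := by positivity
  have hden : 1 ≤ 1 + ε * ‖x‖ ^ 2 := by nlinarith [norm_nonneg x]
  have hw1 : w ≤ 1 := inv_le_one_of_one_le₀ hden
  have hd : 1 ≤ w * (e 0 ^ 2 - e 1 ^ 2) := by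
    by_contra hlt
    rw [not_le] at hlt
    have : w * (amp γ T t * (e 0 ^ 2 - e 1 ^ 2)) < amp γ T t := by nlinarith
    linarith
  have hdiff : e 0 ^ 2 - e 1 ^ 2 ≤ 1 := by nlinarith [sq_nonneg (e 1), sq_nonneg (e 2)]
  have hw_eq : w = 1 := by
    apply le_antisymm hw1
    nlinarith
  have hx : x = 0 := by
    have h1 : 1 + ε * ‖x‖ ^ 2 = 1 := by
      have := hw_eq
      rw [hw] at this
      have h' : (1 + ε * ‖x‖ ^ 2)⁻¹ * (1 + ε * ‖x‖ ^ 2) = 1 := inv_mul_cancel₀ (by positivity)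
      rw [this, one_mul] at h'
      exact h'
    have h2 : ‖x‖ ^ 2 = 0 := by nlinarith
    have h3 : ‖x‖ = 0 := pow_eq_zero_iff (n := 2) (by norm_num) |>.1 h2
    exact norm_eq_zero.1 h3
  rw [hw_eq, one_mul] at hd
  have he1 : e 1 = 0 := by nlinarith [sq_nonneg (e 1), sq_nonneg (e 2)]
  have he2 : e 2 = 0 := by nlinarith [sq_nonneg (e 1), sq_nonneg (e 2)]
  refine ⟨hx, ?_, he1, he2⟩
  rw [he1, he2] at hn
  linarith

/-! ## §6 The rate `b = (1+γ−c)·a = σ/(T−t)` and D6's feed clause WITH EQUALITY -/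
/-- support (definition): the excess rate `b(t) = (1+γ−c)·a(t)` (`= σ/(T−t)`, `σ = (1+γ−c)/γ`). -/
def rate (γ T c : ℝ) (t : ℝ) : ℝ := (1 + γ - c) * amp γ T t
/-- `b(t) = σ/(T−t)` with `σ = (1+γ−c)/γ`. -/
theorem rate_eq (γ T c t : ℝ) : rate γ T c t = (1 + γ - c) / γ * (T - t)⁻¹ := by
  rw [rate, amp, mul_inv]
  ring

/-- At every exact penalised maximiser the TOTAL feed is `(1+γ)q² = c·q² + b(t)·q` EXACTLY (`x̄ = 0`, `ē = ±e₀`,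
no drift, `q = a(t)`). -/
theorem totalFeed_eq_budgeted {γ T c ε t : ℝ} (hε : 0 < ε) (ha : 0 < amp γ T t)
    {x e : EuclideanSpace ℝ (Fin 3)} (h : IsStrainPenalisedArgmax ε (u γ T) t x e) :
    strainFeed (u γ T) (p γ T) t x e + Real.sqrt ε * ‖u γ T t x‖ * strainQuad (u γ T) t x e =
      c * strainQuad (u γ T) t x e ^ 2 + rate γ T c t * strainQuad (u γ T) t x e := by
  obtain ⟨hx, he0, he1, _⟩ := eq_of_isStrainPenalisedArgmax hε ha h
  subst hx
  rw [strainFeed_u, strainQuad_u, u_apply_zero, norm_zero, he0, he1, rate]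
  ring

/-- It is also `(1+γ)·q² > q²`: strictly SUPER-parity by the fixed factor `1+γ` (so D1/D4 and every zero-budget door
fail on this flow, as they must: it blows up). -/
theorem totalFeed_eq_superParity {γ T ε t : ℝ} (hε : 0 < ε) (ha : 0 < amp γ T t)
    {x e : EuclideanSpace ℝ (Fin 3)} (h : IsStrainPenalisedArgmax ε (u γ T) t x e) :
    strainFeed (u γ T) (p γ T) t x e + Real.sqrt ε * ‖u γ T t x‖ * strainQuad (u γ T) t x e =
      (1 + γ) * strainQuad (u γ T) t x e ^ 2 := by
  obtain ⟨hx, he0, he1, _⟩ := eq_of_isStrainPenalisedArgmax hε ha h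
  subst hx
  rw [strainFeed_u, strainQuad_u, u_apply_zero, norm_zero, he0, he1]
  ring

/-! ## §7 The primitive `Φ(t) = σ·log(T/(T−t))`: `Φ(0) = 0`, `0 ≤ Φ`, `Φ′ = b` on `[0,T)`, and `Φ ↑ +∞` -/
/-- support (definition): the budget `Φ(t) = ((1+γ−c)/γ)·log(T/(T−t))`. -/
def budget (γ T c : ℝ) (t : ℝ) : ℝ := (1 + γ - c) / γ * Real.log (T / (T - t))
/-- `Φ(0) = 0`. -/
theorem budget_zero (γ c : ℝ) {T : ℝ} (hT : 0 < T) : budget γ T c 0 = 0 := by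
  simp [budget, div_self hT.ne']
/-- `0 ≤ Φ(t)` for `0 ≤ t < T` when `γ > 0`, `c < 1`. -/
theorem budget_nonneg {γ T c t : ℝ} (hγ : 0 < γ) (hc : c < 1) (ht0 : 0 ≤ t) (ht : t < T) :
    0 ≤ budget γ T c t := by
  have hTt : 0 < T - t := sub_pos.2 ht
  have h1 : 1 ≤ T / (T - t) := by
    rw [le_div_iff₀ hTt]
    linarith
  exact mul_nonneg (div_nonneg (by linarith) hγ.le) (Real.log_nonneg h1)

/-- `Φ′ = b` at every `t < T` (`T > 0`). -/
theorem hasDerivAt_budget {γ T c t : ℝ} (hγ : 0 < γ) (hT : 0 < T) (ht : t < T) :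
    HasDerivAt (budget γ T c) (rate γ T c t) t := by
  have hTt : T - t ≠ 0 := (sub_pos.2 ht).ne'
  have h1 : HasDerivAt (fun s => T - s) (0 - 1) t := (hasDerivAt_const t T).sub (hasDerivAt_id t)
  have h2 : HasDerivAt (fun s => (T - s)⁻¹) (-(0 - 1) / (T - t) ^ 2) t := h1.inv hTt
  have h3 := h2.const_mul T
  have hf : T * (T - t)⁻¹ ≠ 0 := mul_ne_zero hT.ne' (inv_ne_zero hTt)
  have h4 := h3.log hf
  have h5 := h4.const_mul ((1 + γ - c) / γ)
  have he : budget γ T c = fun s => (1 + γ - c) / γ * Real.log (T * (T - s)⁻¹) := by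
    funext s
    rw [budget, div_eq_mul_inv T]
  rw [he]
  refine h5.congr_deriv ?_
  rw [rate, amp]
  field_simp
  ring

/-- `Φ(t) → +∞` as `t ↑ T`: the budget of the bursting strain is NOT bounded — the one hypothesis of D6 it violates. -/
theorem tendsto_budget_atTop {γ T c : ℝ} (hγ : 0 < γ) (hT : 0 < T) (hc : c < 1) :
    Tendsto (budget γ T c) (𝓝[<] T) atTop := by
  have h1 : Tendsto (fun t => (T - t)⁻¹) (𝓝[<] T) atTop := tendsto_inv_nhdsGT_zero.comp (tendsto_sub_nhdsLT T)
  have h2 : Tendsto (fun t => T * (T - t)⁻¹) (𝓝[<] T) atTop := h1.const_mul_atTop hT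
  have h3 : Tendsto (fun t => Real.log (T * (T - t)⁻¹)) (𝓝[<] T) atTop := Real.tendsto_log_atTop.comp h2
  have h4 := h3.const_mul_atTop (div_pos (by linarith : (0 : ℝ) < 1 + γ - c) hγ)
  have he : budget γ T c = fun s => (1 + γ - c) / γ * Real.log (T * (T - s)⁻¹) := by
    funext s
    rw [budget, div_eq_mul_inv T]
  rw [he]
  exact h4

/-! ## §8 The charged weighted strain `(1+ε‖0‖²)⁻¹ q(t,0,e₀) = (γ(T−t))⁻¹` blows up at `T` -/
/-- The charged weighted strain at `(0, e₀)` equals `(γ(T−t))⁻¹`. -/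
theorem weightedStrain_origin (γ T ε t : ℝ) :
    (1 + ε * ‖(0 : EuclideanSpace ℝ (Fin 3))‖ ^ 2)⁻¹ * strainQuad (u γ T) t 0 (EuclideanSpace.single 0 1)
      = (γ * (T - t))⁻¹ := by
  rw [strainQuad_u]
  simp [amp]
/-- The charged weighted strain at `(0, e₀)` tends to `+∞` as `t ↑ T`. -/
theorem tendsto_weightedStrain_atTop {γ T : ℝ} (hγ : 0 < γ) (ε : ℝ) :
    Tendsto (fun t => (1 + ε * ‖(0 : EuclideanSpace ℝ (Fin 3))‖ ^ 2)⁻¹ *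
      strainQuad (u γ T) t 0 (EuclideanSpace.single 0 1)) (𝓝[<] T) atTop := by
  have he : (fun t => (1 + ε * ‖(0 : EuclideanSpace ℝ (Fin 3))‖ ^ 2)⁻¹ *
      strainQuad (u γ T) t 0 (EuclideanSpace.single 0 1)) = amp γ T := by
    funext t
    rw [weightedStrain_origin, amp]
  rw [he]
  exact tendsto_amp_atTop hγ

/-- For every `M` the charged weighted strain exceeds `M` at some time of `(T/2, T)` — whereas D6's bound
`e^{β}(ℓ + 6νε/(1−c) + 1/((1−c)t))` (`t₀ = 0`) is bounded on `(T/2, T)`: D6's conclusion fails for every `β`. -/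
theorem weightedStrain_unbounded {γ T : ℝ} (hγ : 0 < γ) (hT : 0 < T) (ε M : ℝ) :
    ∃ t ∈ Ioo (T / 2) T, M < (1 + ε * ‖(0 : EuclideanSpace ℝ (Fin 3))‖ ^ 2)⁻¹ *
      strainQuad (u γ T) t 0 (EuclideanSpace.single 0 1) := by
  have h1 := (tendsto_weightedStrain_atTop (T := T) hγ ε).eventually_gt_atTop M
  have h2 : ∀ᶠ t in 𝓝[<] T, t ∈ Ioo (T / 2) T := Ioo_mem_nhdsLT (by linarith)
  obtain ⟨t, ht1, ht2⟩ := (h1.and h2).exists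
  exact ⟨t, ht2, ht1⟩

/-! ## §9 Packaged in D6's binder shapes: every hypothesis except `Φ ≤ β`, and the conclusion fails -/
/-- **D6 «BudgetedDriftSmoothing» is sharp at the log scale (ROUND-40).** For every `γ > 0`, `T > 0`, `c < 1`,
`ε > 0` and every level `ℓ`, the bursting planar strain `(u,p)` (`a(t) = (γ(T−t))⁻¹`): (i) is a classical
Navier–Stokes solution on `[0,T) × ℝ³`; (ii) has `∇u` bounded on every `[0,T'] × ℝ³`, `T' < T` (D6's frame);
(iii) its budget `Φ = budget γ T c` has `Φ(0) = 0`, `0 ≤ Φ`, `Φ′ = b = rate γ T c` on `[0,T)` — and `Φ → +∞` at `T`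
(the ONLY clause of D6 that fails is `Φ ≤ β`); (iv) D6's charged feed clause holds on `[0,T)` with this `b` (with
equality, §6); (v) the clause is charged at every time, at `(0,e₀)`, with weighted strain `(γ(T−t))⁻¹`; (vi) which
tends to `+∞` as `t ↑ T` — so D6's conclusion fails for every `β`. [this file] -/
theorem budgetedDriftSmoothing_sharp (ν T ε ℓ c γ : ℝ) (hε : 0 < ε) (hγ : 0 < γ) (hT : 0 < T) (hc : c < 1) :
    IsClassicalNSSolutionOn (Ico 0 T) ν 0 (u γ T) (p γ T) ∧
    (∀ T' : ℝ, T' < T → ∃ K : ℝ, ∀ t ∈ Icc 0 T', ∀ x : EuclideanSpace ℝ (Fin 3), ‖fderiv ℝ (u γ T t) x‖ ≤ K) ∧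
    (budget γ T c 0 = 0 ∧
      (∀ t ∈ Ico (0 : ℝ) T, 0 ≤ budget γ T c t ∧ HasDerivAt (budget γ T c) (rate γ T c t) t) ∧
      Tendsto (budget γ T c) (𝓝[<] T) atTop) ∧
    (∀ t ∈ Ico (0 : ℝ) T, ∀ (x e : EuclideanSpace ℝ (Fin 3)), IsStrainPenalisedArgmax ε (u γ T) t x e →
      ℓ < (1 + ε * ‖x‖ ^ 2)⁻¹ * strainQuad (u γ T) t x e →
      strainFeed (u γ T) (p γ T) t x e + Real.sqrt ε * ‖u γ T t x‖ * strainQuad (u γ T) t x e ≤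
        c * strainQuad (u γ T) t x e ^ 2 + rate γ T c t * strainQuad (u γ T) t x e) ∧
    (∀ t ∈ Ico (0 : ℝ) T,
      IsStrainPenalisedArgmax ε (u γ T) t 0 (EuclideanSpace.single 0 1) ∧
      (1 + ε * ‖(0 : EuclideanSpace ℝ (Fin 3))‖ ^ 2)⁻¹ * strainQuad (u γ T) t 0 (EuclideanSpace.single 0 1)
        = (γ * (T - t))⁻¹) ∧
    Tendsto (fun t => (1 + ε * ‖(0 : EuclideanSpace ℝ (Fin 3))‖ ^ 2)⁻¹ *
      strainQuad (u γ T) t 0 (EuclideanSpace.single 0 1)) (𝓝[<] T) atTop := by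
  refine ⟨isClassicalNSSolutionOn hγ ν, fderiv_locally_bounded hγ, ⟨budget_zero γ c hT, fun t ht =>
    ⟨budget_nonneg hγ hc ht.1 ht.2, hasDerivAt_budget hγ hT ht.2⟩, tendsto_budget_atTop hγ hT hc⟩,
    fun t ht x e hpen _ => (totalFeed_eq_budgeted (c := c) hε (amp_pos hγ ht.2) hpen).le,
    fun t ht => ⟨isStrainPenalisedArgmax_origin hε (amp_pos hγ ht.2), weightedStrain_origin γ T ε t⟩,
    tendsto_weightedStrain_atTop hγ ε⟩

end PlanarStrainBurst

end

end Summit.NavierStokesRegularity.NavierStokesRegularity.Theorems.StrainDoors
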